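import Summits.AtomisticToContinuum.BoseEinsteinCondensation.Theorems.BECRewardDescentCondensedTrialStateJastrow
import Literature.MathematicalPhysics.QuantumManyBody.BoseGasThermodynamicLimitRuelle

/-!
# Route `BECRewardDescent`, support item `CondensedTrialState` (stmt-AtomisticToContinuum-12879)

For every repulsive finite-range pair potential `v` (hard cores allowed) and every `η > 0` there is
`ρ₀ > 0` such that for `0 < ρ < ρ₀` and all large `N`, on the torus of side `L = (N/ρ)^{1/3}`, some
periodic `C¹` Bose-symmetric normalised trial state `Φ` has BOTH
`⟨Φ, HΦ⟩ ≤ 4πaρ(1+η)N` AND `⟨Φ, n₀Φ⟩ ≥ (1-η)N` (`a` the scattering length, `n₀` the number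
operator of the constant mode).

## The proof

The state is the in-tree Jastrow (pair-product) trial state `Ψ_φ = ∏_{i<j} Φ(xᵢ - xⱼ)/‖·‖`
(`IsPairProfile.trialState`) of the proof of [LSSY2005, Thm. 2.2], with the Dyson profile of cut-off
`b` FIXED in terms of `(v, η)` (not `b ∼ ρ^{-1/3}` as in the energy-optimal choice) and then
`ρ → 0`:

* **energy** — the tree's `IsPairProfile.periodicEnergy_trialState_le` (LSSY (2.19)–(2.31) for the
  trial state itself) with the profile of `LSSY2005_dysonProfile_holds` (`E₁ ≤ 8πa/(1-a/b) + ε`,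
  `I ≤ 16πab²`, `K ≤ 16πab`): per particle `≤ (E₁/2)ρ(1+δ) + K²ρ²(1+δ)² ≤ 4πaρ(1+η)` once
  `a/b ≤ δ`, `ε = 8πaδ`, `ρ ≤ δ/(256πab²)`, `δ = min(η,1)/8` (`jastrow_parameter_bound`);
* **condensation of the same state** — `le_condensateOccupation_trialState` of the helper file
  (union bound on the slice product): `⟨Ψ_φ, n₀ Ψ_φ⟩ ≥ (1 - (N-1)I/L³) N ≥ (1 - ρI) N ≥ (1-η)N`;
* `a = 0` forces `v = 0` a.e. (`LSSY2005_zeroScatteringLength_holds`), where `φ ≡ 1` gives the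
  constant state (energy `0`, fully condensed); `a < ∞` by finite range
  (`scatteringLength_ne_top_of_finiteRange`); `2b < L` and `N ≥ 2` eventually
  (`tendsto_sideLength_atTop`).

References: LSSY 2005 (arXiv:cond-mat/0610117), Thm. 2.2 and its proof (2.15)–(2.33), App. C
Thm. C.1; Dyson 1957; Penrose–Onsager 1956.
-/

noncomputable section

namespace Summit.AtomisticToContinuum.BoseEinsteinCondensation.Theorems

open MeasureTheory Filter Finset
open scoped ENNReal NNReal
open Literature.MathematicalPhysics.QuantumManyBody.BoseGas

/-! ### The item -/

section Main

/-- **`CondensedTrialState` holds** (settles stmt-AtomisticToContinuum-12879, exact route decl): for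
every repulsive finite-range `v` and `η > 0` there is `ρ₀ > 0` such that for `0 < ρ < ρ₀` and all
large `N`, with `L = (N/ρ)^{1/3}`, some periodic trial state `Φ` has
`periodicEnergy v Φ ≤ 4πaρ(1+η)N` and `condensateOccupation N L Φ.ψ ≥ (1-η)N`. The state is the
Jastrow product of the Dyson profile with cut-off `b = max(b₀(v), 8a/min(η,1))`, at densities
`ρ < min(η,1)/(2048πab²)`; for `a = 0` (i.e. `v = 0` a.e.) it is the constant state.
[cite: LSSY2005, Thm. 2.2, proof, (2.15)–(2.33)] -/
theorem condensedTrialState_proof :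
    Summit.AtomisticToContinuum.BoseEinsteinCondensation.Theses.BECRewardDescent.CondensedTrialState := by
  unfold Summit.AtomisticToContinuum.BoseEinsteinCondensation.Theses.BECRewardDescent.CondensedTrialState
  intro v hv η hη
  obtain ⟨hvm, R₀, hR⟩ := hv
  have hatop : scatteringLength v ≠ ⊤ := scatteringLength_ne_top_of_finiteRange hR
  have hπ := Real.pi_pos
  -- positivity of the side length
  have hLpos : ∀ {ρ : ℝ}, 0 < ρ → ∀ {N : ℕ}, 2 ≤ N → 0 < sideLength ρ N := by
    intro ρ hρ N hN
    unfold sideLength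
    exact Real.rpow_pos_of_pos (div_pos (by exact_mod_cast (by omega : 0 < N)) hρ) _
  rcases eq_or_ne (scatteringLength v) 0 with ha0 | ha0
  · -- `a = 0`: `v = 0` a.e. and the constant state
    have hv0 : ∀ᵐ x : Space, v ‖x‖ = 0 := LSSY2005_zeroScatteringLength_holds v R₀ hvm hR ha0
    refine ⟨1, one_pos, fun ρ hρ _ => ?_⟩
    filter_upwards [eventually_ge_atTop 2] with N hN
    dsimp only
    have hL : 0 < sideLength ρ N := hLpos hρ hN
    set L := sideLength ρ N with hL_def
    have hβL : 2 * (L / 4) < L := by linarith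
    obtain ⟨Ψ, hE, hC⟩ := exists_trialState_energy_condensation (E := 0) (I := 0) (K := 0) hvm hN
      hL hβL (isPairProfile_one (L / 4)) le_rfl le_rfl le_rfl
      (by rw [profileEnergy_one_eq_zero hv0]; exact bot_le) (by simp) (by simp)
      (by simp only [mul_zero]; positivity)
    refine ⟨Ψ, ?_, ?_⟩
    · calc periodicEnergy v Ψ ≤ _ := hE
        _ = 0 := by simp
        _ ≤ _ := bot_le
    · refine le_trans (ENNReal.ofReal_le_ofReal ?_) hC
      have : (0 : ℝ) ≤ N := Nat.cast_nonneg _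
      simp only [mul_zero, zero_div, sub_zero, mul_one]
      nlinarith
  · -- `a > 0`: the Dyson profile with a fixed cut-off
    have ha_pos : 0 < scatteringLength v := pos_iff_ne_zero.mpr ha0
    obtain ⟨b₀, hab₀, hprof⟩ := LSSY2005_dysonProfile_holds v R₀ hvm hR hatop ha_pos
    set a := (scatteringLength v).toReal with ha_def
    have ha : 0 < a := ENNReal.toReal_pos ha_pos.ne' hatop
    -- parameters `δ`, `b`, `ε = 8πaδ`
    set δ : ℝ := min η 1 / 8 with hδ_def
    have hmin : 0 < min η 1 := lt_min hη one_pos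
    have hδ : 0 < δ := by positivity
    have hδ1 : δ ≤ 1 / 8 := by
      have := min_le_right η 1
      rw [hδ_def]; linarith
    have hδη : 7 * δ ≤ η := by
      have := min_le_left η 1
      rw [hδ_def]; linarith
    set b : ℝ := max b₀ (a / δ) with hb_def
    have hb₀b : b₀ ≤ b := le_max_left _ _
    have hb : 0 < b := lt_of_lt_of_le (div_pos ha hδ) (le_max_right _ _)
    have hab : a / b ≤ δ := by
      rw [div_le_iff₀ hb]
      have h := le_max_right b₀ (a / δ)
      rw [← hb_def, div_le_iff₀ hδ] at h
      linarith
    have hab1 : a / b < 1 := by linarith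
    obtain ⟨φ, hφ, hφE, hφI, hφK⟩ := hprof b (8 * Real.pi * a * δ) hb₀b (by positivity)
    have hE0 : 0 ≤ 8 * Real.pi * a / (1 - a / b) + 8 * Real.pi * a * δ := by
      have : 0 ≤ 8 * Real.pi * a / (1 - a / b) := div_nonneg (by positivity) (by linarith)
      positivity
    refine ⟨δ / (256 * Real.pi * a * b ^ 2), by positivity, fun ρ hρ hρ₀ => ?_⟩
    have hev : ∀ᶠ N : ℕ in atTop, 2 * b < sideLength ρ N :=
      (tendsto_sideLength_atTop hρ).eventually_gt_atTop (2 * b)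
    filter_upwards [eventually_ge_atTop 2, hev] with N hN hbL
    dsimp only
    have hL : 0 < sideLength ρ N := hLpos hρ hN
    have hM : sideLength ρ N ^ 3 = N / ρ := sideLength_pow_three hρ N
    set L := sideLength ρ N with hL_def
    obtain ⟨hNI, hEN, hCN⟩ := jastrow_parameter_bound ha hb hδ hδ1 hδη hab hρ hρ₀.le
      (by exact_mod_cast hN) hM
    obtain ⟨Ψ, hE, hC⟩ := exists_trialState_energy_condensation
      (E := 8 * Real.pi * a / (1 - a / b) + 8 * Real.pi * a * δ) (I := 16 * Real.pi * a * b ^ 2)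
      (K := 16 * Real.pi * a * b) hvm hN hL hbL hφ hE0 (by positivity) (by positivity)
      hφE hφI hφK hNI
    exact ⟨Ψ, hE.trans (ENNReal.ofReal_le_ofReal hEN), (ENNReal.ofReal_le_ofReal hCN).trans hC⟩

end Main

end Summit.AtomisticToContinuum.BoseEinsteinCondensation.Theorems

end
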